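import Summits.BirchSwinnertonDyer.BirchSwinnertonDyer.Theses.GenusKolyvaginAtTwo
import Summits.BirchSwinnertonDyer.BirchSwinnertonDyer.Theorems.ByReductionTypeAtTwoRankOneAtTwoOffBigImageOddLocalDefs
import HarnessLib

/-!
# Route `ByReductionTypeAtTwo`, crux `RankOneAtTwoOffBigImageOddLocal` (stmt-BirchSwinnertonDyer-23716), line
# `refined_kolyvagin_tamagawa_shift_at_two` — the registered stub S5′ against the sibling route's crux `KolyvaginExactAtTwo`

Lead prover `prover-cruxlead-stmt-BirchSwinnertonDyer-23716-g3` (2026-08-28).  The registered K3 stub of line 1,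
`ShiftedKolyvaginStructureModTwoAtTwo` (S5′: McCallum's structure theorem at `p = 2` on the mod-`2`-surjective S₃-locus with the
Tamagawa/datum shift `σ(W, Dt) = v₂ ∏ c_ℓ(W) + v₂ c(Dt)`), and the parent crux of route `GenusKolyvaginAtTwo`,
`KolyvaginExactAtTwo` (stmt-BirchSwinnertonDyer-22137: the same structure theorem at `2` on the FULL `2`-adic-image habitat, unshifted),
COINCIDE on the common ground {`ρ_{W,2^∞}` onto, data with `σ(W, Dt) = 0`}, binder for binder:

* `shiftedStructure_of_kolyvaginExactAtTwo_of_sigmaShift_eq_zero` — 22137 ⟹ S5′ at every full-image curve and every datum with `σ = 0`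
  (the K1-shape hypothesis of S5′ is not even needed; `2^{σ+1} = 2`);
* `kolyvaginExactAtTwo_of_shiftedStructure_of_sigmaShift_eq_zero` — S5′ ⟹ 22137 at every datum with `σ = 0` (the K1-shape hypothesis
  S5′ asks for is vacuous at `σ = 0`; the level condition `M(n) ≥ σ + 1 = 1` is automatic for a product of Kolyvagin primes at `2`,
  `Zhang2014.IsKolyvaginPrime … ⇒ 0 < M(ℓ)`; mod-`2` surjectivity is the `n = 1` case of the full image).

So S5′ ∩ {δ, σ = 0} ≡ 22137 ∩ {σ = 0} in the kernel: the registered stub CONTAINS the sibling route's open L-crux on that ground and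
EXCEEDS it by (i) the shift `σ ≥ 1` (even `∏ c_ℓ` or even datum constant — where 22137's own hypothesis «some `P(n) ∉ 2E(K_n)`»
is expected to fail by Σ-accumulation, S3′) and (ii) the γ₂ cells (mod-`2` onto, `2`-adic image not onto).  This is the kernel-checked
evidence for the lead's `promote-stub` verdict on S5′ (it is crux-sized: it contains a crux).  Pure binder bookkeeping; nothing here
proves S5′, 22137, `BSDp W 2`, BSD or the summit.  BSD is not proved.

Refs: [McCallumLMS1991] §5; [WZhang2014] Notations (xii); [Jetchev2008] (1.3).
-/

set_option linter.dupNamespace false -- tree convention: `Summit.BirchSwinnertonDyer.BirchSwinnertonDyer.Theorems` (summit = sub-problem)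
set_option autoImplicit false

noncomputable section

open scoped Classical

namespace Summit.BirchSwinnertonDyer.BirchSwinnertonDyer.Theorems.OffBigImageOddLocalAtTwo

open WeierstrassCurve NumberField Literature.NumberTheory.EllipticCurves
  Literature.NumberTheory.EllipticCurves.ModularForms
  Summit.BirchSwinnertonDyer.BirchSwinnertonDyer.Theses.GenusKolyvaginAtTwo

/-- **22137 ⟹ S5′ on {full `2`-adic image, `σ(W, Dt) = 0`}.**  For `W` globally minimal non-CM with `ρ_{W,2^n}` onto for every `n`,
a Kolyvagin-admissible `K` (odd `d_K ≠ −3`, Heegner hypothesis, Kolyvagin's two exclusions), any datum `Dt` with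
`σ(W, Dt) = v₂ ∏ c_ℓ + v₂ c(Dt) = 0`, `y_K = P(1)` of infinite order with `2^{M₀} ∥ P(1)`, and a square-free product `n` of Kolyvagin
primes at `2` whose derived point `P(n)` is not `2^{σ+1} = 2`-divisible in `E(K[n])`: `#Ш(E/K)[2^∞] = 2^{2(M₀ − σ)} = 2^{2M₀}` — by the
sibling crux `KolyvaginExactAtTwo` verbatim. [cite: McCallumLMS1991, §5 Thm. (Kolyvagin)] -/
theorem shiftedStructure_of_kolyvaginExactAtTwo_of_sigmaShift_eq_zero (h : KolyvaginExactAtTwo)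
    (W : WeierstrassCurve ℚ) [W.IsElliptic] [W.IsGloballyMinimal] [NeZero (W.conductorNorm ℤ)]
    (hCM : ¬ W.HasCM) (hfull : ∀ n : ℕ, W.HasSurjectiveModNGaloisRep ((2 ^ n : ℕ) : ℤ))
    (K : Type) [Field K] [NumberField K] (hK : IsImaginaryQuadratic K) (hodd : Odd (NumberField.discr K))
    (h3 : NumberField.discr K ≠ -3) (hH : SatisfiesHeegnerHypothesis (W.conductorNorm ℤ) K)
    (hsq1 : ¬ IsSquare ((NumberField.discr K : ℚ) * -|W.Δ|)) (hsq2 : ¬ IsSquare ((NumberField.discr K : ℚ) * (-(2 * |W.Δ|))))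
    (Dt : ModularParametrizationData W (W.conductorNorm ℤ)) (β : ℤ) (ι : K →+* ℂ) (d₁ : KolyvaginHeegnerData Dt β ι 1)
    (hy : ¬ IsOfFinAddOrder d₁.derivedPoint) (hσ : sigmaShift W Dt = 0) (M₀ : ℕ)
    (hdiv : ∃ Q : (W.baseChange (ringClassField K ι 1)).toAffine.Point, ((2 ^ M₀ : ℕ) : ℤ) • Q = d₁.derivedPoint)
    (hndiv : ¬ ∃ Q : (W.baseChange (ringClassField K ι 1)).toAffine.Point, ((2 ^ (M₀ + 1) : ℕ) : ℤ) • Q = d₁.derivedPoint)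
    (n : ℕ) (d : KolyvaginHeegnerData Dt β ι n) (hn : Squarefree n)
    (hKoly : ∀ ℓ ∈ n.primeFactors, Zhang2014.IsKolyvaginPrime (W.conductorNorm ℤ) W K 2 ℓ)
    (hPn : ¬ ∃ Q : (W.baseChange (ringClassField K ι n)).toAffine.Point,
      ((2 ^ (sigmaShift W Dt + 1) : ℕ) : ℤ) • Q = d.derivedPoint) :
    Nat.card (AddCommGroup.primaryComponent (W.baseChange K).sha 2) = 2 ^ (2 * (M₀ - sigmaShift W Dt)) := by
  have hfull' : ∀ m : ℕ, 0 < m → W.HasSurjectiveModNGaloisRep ((2 : ℤ) ^ m) := fun m _ => by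
    have := hfull m
    push_cast at this
    exact this
  have hPn' : ¬ ∃ Q : (W.baseChange (ringClassField K ι n)).toAffine.Point, (2 : ℤ) • Q = d.derivedPoint := by
    rw [hσ] at hPn
    simpa using hPn
  rw [hσ, Nat.sub_zero]
  exact h W hCM K hK hodd h3 hH hsq1 hsq2 hfull' Dt β ι d₁ hy M₀ hdiv hndiv n d hn hKoly hPn'

/-- **S5′ ⟹ 22137 on {`σ(W, Dt) = 0`}.**  The registered stub `ShiftedKolyvaginStructureModTwoAtTwo` gives the sibling crux
`KolyvaginExactAtTwo` at every datum with `σ(W, Dt) = 0`: mod-`2` surjectivity is the `n = 1` case of the full image, S5′'s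
Σ-accumulation hypothesis (K1-shape, `m ≤ min(σ, M(n)) = 0`) is vacuous, the level condition `M(n) ≥ σ + 1 = 1` holds for every
square-free product of Kolyvagin primes at `2` (`0 < M(ℓ)` is part of `Zhang2014.IsKolyvaginPrime`), and `2^{σ+1} = 2`.
[cite: McCallumLMS1991, §5 Thm. (Kolyvagin)] [cite: WZhang2014, Notations (xii)] -/
theorem kolyvaginExactAtTwo_of_shiftedStructure_of_sigmaShift_eq_zero (h : ShiftedKolyvaginStructureModTwoAtTwo)
    (W : WeierstrassCurve ℚ) [W.IsElliptic] [W.IsGloballyMinimal] [NeZero (W.conductorNorm ℤ)]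
    (hCM : ¬ W.HasCM) (K : Type) [Field K] [NumberField K] (hK : IsImaginaryQuadratic K) (hodd : Odd (NumberField.discr K))
    (h3 : NumberField.discr K ≠ -3) (hH : SatisfiesHeegnerHypothesis (W.conductorNorm ℤ) K)
    (hsq1 : ¬ IsSquare ((NumberField.discr K : ℚ) * -|W.Δ|)) (hsq2 : ¬ IsSquare ((NumberField.discr K : ℚ) * (-(2 * |W.Δ|))))
    (hfull : ∀ m : ℕ, 0 < m → W.HasSurjectiveModNGaloisRep ((2 : ℤ) ^ m))
    (Dt : ModularParametrizationData W (W.conductorNorm ℤ)) (β : ℤ) (ι : K →+* ℂ) (d₁ : KolyvaginHeegnerData Dt β ι 1)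
    (hy : ¬ IsOfFinAddOrder d₁.derivedPoint) (hσ : sigmaShift W Dt = 0) (M₀ : ℕ)
    (hdiv : ∃ Q : (W.baseChange (ringClassField K ι 1)).toAffine.Point, ((2 ^ M₀ : ℕ) : ℤ) • Q = d₁.derivedPoint)
    (hndiv : ¬ ∃ Q : (W.baseChange (ringClassField K ι 1)).toAffine.Point, ((2 ^ (M₀ + 1) : ℕ) : ℤ) • Q = d₁.derivedPoint)
    (n : ℕ) (d : KolyvaginHeegnerData Dt β ι n) (hn : Squarefree n)
    (hKoly : ∀ ℓ ∈ n.primeFactors, Zhang2014.IsKolyvaginPrime (W.conductorNorm ℤ) W K 2 ℓ)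
    (hPn : ¬ ∃ Q : (W.baseChange (ringClassField K ι n)).toAffine.Point, (2 : ℤ) • Q = d.derivedPoint) :
    Nat.card (AddCommGroup.primaryComponent (W.baseChange K).sha 2) = 2 ^ (2 * M₀) := by
  have hρ2 : W.HasSurjectiveModNGaloisRep 2 := by simpa using hfull 1 one_pos
  -- Σ-accumulation hypothesis of S5′ is vacuous at `σ = 0`
  have hacc : ∀ (n' : ℕ) (d' : KolyvaginHeegnerData Dt β ι n') (m : ℕ), Squarefree n' →
      (∀ ℓ ∈ n'.primeFactors, Zhang2014.IsKolyvaginPrime (W.conductorNorm ℤ) W K 2 ℓ) →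
      (m : ℕ∞) ≤ Zhang2014.levelIndex W 2 n' → m ≤ sigmaShift W Dt →
      ∃ Q : (W.baseChange (ringClassField K ι n')).toAffine.Point, ((2 ^ m : ℕ) : ℤ) • Q = d'.derivedPoint := by
    intro n' d' m _ _ _ hm
    rw [hσ, Nat.le_zero] at hm
    subst hm
    exact ⟨d'.derivedPoint, by simp⟩
  -- the level condition `M(n) ≥ 1` for a product of Kolyvagin primes at `2`
  have hlev : ((sigmaShift W Dt + 1 : ℕ) : ℕ∞) ≤ Zhang2014.levelIndex W 2 n := by
    rw [hσ, zero_add]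
    exact Zhang2014.natCast_le_levelIndex_iff.mpr fun ℓ hℓ => (hKoly ℓ hℓ).2.2.2.2.2
  have hPn' : ¬ ∃ Q : (W.baseChange (ringClassField K ι n)).toAffine.Point,
      ((2 ^ (sigmaShift W Dt + 1) : ℕ) : ℤ) • Q = d.derivedPoint := by
    rw [hσ]
    simpa using hPn
  have := h W hCM hρ2 K hK hodd h3 hH hsq1 hsq2 Dt β ι d₁ hy M₀ hdiv hndiv hacc n d hn hKoly hlev hPn'
  rwa [hσ, Nat.sub_zero] at this

end Summit.BirchSwinnertonDyer.BirchSwinnertonDyer.Theorems.OffBigImageOddLocalAtTwo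

end
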